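import Summits.ValiantsHypothesis.ValiantsHypothesis.Theorems.KPlusLogSqLawTropicalBBanded
import Summits.ValiantsHypothesis.ValiantsHypothesis.Theorems.KPlusLogSqLawTropicalBTranspose

/-!
# Route `KPlusLogSqLaw`, crux `TropicalB` — the HALL-SURPLUS sector (column orders of small neighbourhood surplus)

HONEST FRAMING.  Helper toward the registered stubs `stub_tropThin` / `stub_tropFat` of
`Cruxes/TropicalB/Lines/birth.lean` (crux `Summit.ValiantsHypothesis.ValiantsHypothesis.Theses.KPlusLogSqLaw.TropicalB`,
ledger item `stmt-ValiantsHypothesis-19771`, route `KPlusLogSqLaw`; cell `pub-symmetroid`, seat `val-sym-trop-p3`,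
2026-08-26).  A SECTOR theorem of an OPEN conjecture: nothing here bounds `TropicalB` for general supports, and nothing
bears on `KPlusLogSqLaw`, `MatrixDescartes` or `VP ≠ VNP`.

THE SECTOR.  A design `ε` of format `m` has (column-order) SURPLUS at most `w` if for every `c` the rows carrying a
present class in some column `< c` number at most `c + w` (hypothesis stated inline:
`∀ c, #{a | ∃ b < c, ∃ l, ε a b l ≠ 0} ≤ c + w`).  Lower bandwidth `w` (`…TropicalBBanded`: `ε a b l ≠ 0 → a ≤ b + w`)
implies surplus `≤ w` (`surplus_of_band`), but the surplus condition sees only the SIZE of the neighbourhood of each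
initial column segment, not its position — a Hall-type width of the support graph (minimised over column orders, a
pathwidth-like parameter).  It is preserved by both restrictions of val-sym-trop-p1's column split
(`surplus_restrict_left/right`: for the second block, `|N([0,c+c'')) ∖ R| = |N([0,c+c''))| − c` because the state `R`
lies inside `N([0,c))`), and the states are the `c`-subsets of `N([0,c))`, at most `C(c+w, c) ≤ (c+1)^w` of them.  The
dyadic recursion of `…TropicalBBanded` then gives, verbatim:

* `designRowD_surplus_pow` / `designRowD_surplus` : unsigned bound `(K+1)·2^((w+1)·(L+1)·(L+2)) − 1`;
* `surplus_kPlusLogSq_fixedWidth` : `C = 6w + 7` for every fixed surplus `w`;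
* `surplus_kPlusLogSq` : ONE constant `C = 7` whenever `w · log₂² m ≤ K` (K-adaptive);
* `surplus_kPlusLogSq_of_relabel` : the same if SOME relabeling of rows and columns has surplus `≤ w` — i.e. for every
  design whose support graph admits a column order of neighbourhood surplus `≤ K / log₂² m`;
* (appended) `surplus_kPlusLogSq_rows` / `surplus_kPlusLogSq_rows_of_relabel` : the ROW twin — initial row segments
  meeting at most `c + w` columns — by val-sym-trop-p1's transposition invariance `…TropicalBTranspose.designRowD_of_transpose`.

[folklore: Gusfield 1980 divide and conquer, Hall-surplus form, in the dominance vocabulary]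
-/

set_option linter.dupNamespace false
set_option autoImplicit false

namespace Summit.ValiantsHypothesis.ValiantsHypothesis.Theorems.KPlusLogSqLaw

open Summit.ValiantsHypothesis.ValiantsHypothesis.Theorems.MatrixDescartes.Negative
open Summit.ValiantsHypothesis.ValiantsHypothesis.Theorems.LacunarySymmetroidMatrixDescartes
open Summit.ValiantsHypothesis.ValiantsHypothesis.Theorems.LacunarySymmetroidMatrixDescartes.TropicalCensus
open scoped BigOperators
open Finset

/-! ## 1. Neighbourhoods of initial column segments -/

section Surplus

variable {m K : ℕ}

/-- monotonicity of the initial-segment neighbourhood in the segment length. [folklore] -/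
theorem nbhd_mono (ε : Fin m → Fin m → Fin K → ℤ) {c c' : ℕ} (h : c ≤ c') :
    (univ : Finset (Fin m)).filter (fun a : Fin m => ∃ b : Fin m, (b : ℕ) < c ∧ ∃ l : Fin K, ε a b l ≠ 0) ⊆
      (univ : Finset (Fin m)).filter (fun a : Fin m => ∃ b : Fin m, (b : ℕ) < c' ∧ ∃ l : Fin K, ε a b l ≠ 0) := by
  intro a ha
  rw [mem_filter] at ha ⊢
  obtain ⟨_, b, hb, l, hl⟩ := ha
  exact ⟨mem_univ _, b, lt_of_lt_of_le hb h, l, hl⟩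

/-- a design of lower bandwidth `w` has surplus at most `w`. [folklore] -/
theorem surplus_of_band (w : ℕ) (ε : Fin m → Fin m → Fin K → ℤ) (hε : ∀ a b l, ε a b l ≠ 0 → (a : ℕ) ≤ (b : ℕ) + w)
    (c : ℕ) :
    ((univ : Finset (Fin m)).filter (fun a : Fin m => ∃ b : Fin m, (b : ℕ) < c ∧ ∃ l : Fin K, ε a b l ≠ 0)).card
      ≤ c + w := by
  refine le_trans (card_le_card fun a ha => ?_) (card_filter_val_lt_le m c w)
  rw [mem_filter] at ha ⊢
  obtain ⟨_, b, hb, l, hl⟩ := ha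
  have := hε _ _ _ hl
  exact ⟨mem_univ _, by omega⟩

end Surplus

/-! ## 2. The surplus condition under the column split -/

section SurplusSplit

variable {c e K : ℕ} (w : ℕ)

/-- the states of a design under the column split: the first-block row set of a present term is a `c`-subset of the
neighbourhood of the first `c` columns. [folklore] -/
theorem surplus_state_mem (ε : Fin (c + e) → Fin (c + e) → Fin K → ℤ)
    (q : Equiv.Perm (Fin (c + e)) × (Fin (c + e) → Fin K)) (hq : termSign ε q ≠ 0) :
    ((univ : Finset (Fin c)).image fun j => q.1 (Fin.castAdd e j)) ∈
      ((univ : Finset (Fin (c + e))).filter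
        (fun a : Fin (c + e) => ∃ b : Fin (c + e), (b : ℕ) < c ∧ ∃ l : Fin K, ε a b l ≠ 0)).powersetCard c := by
  classical
  rw [mem_powersetCard]
  refine ⟨fun x hx => ?_, ?_⟩
  · obtain ⟨j, _, rfl⟩ := mem_image.mp hx
    have hpres := (termSign_ne_zero_iff ε q).mp hq (Fin.castAdd e j)
    exact mem_filter.mpr ⟨mem_univ _, Fin.castAdd e j, by simp, _, hpres⟩
  · have hinj : Function.Injective fun j : Fin c => q.1 (Fin.castAdd e j) :=
      q.1.injective.comp (Fin.castAdd_injective _ _)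
    rw [card_image_of_injective _ hinj, card_univ, Fintype.card_fin]

/-- **at most `(c+1)^w` states** under surplus `≤ w`: `C(#N, c) ≤ C(c+w, c) = multichoose (w+1) c ≤ (c+1)^w`. [folklore] -/
theorem card_surplusStates_le (ε : Fin (c + e) → Fin (c + e) → Fin K → ℤ)
    (hN : ((univ : Finset (Fin (c + e))).filter
        (fun a : Fin (c + e) => ∃ b : Fin (c + e), (b : ℕ) < c ∧ ∃ l : Fin K, ε a b l ≠ 0)).card ≤ c + w) :
    (((univ : Finset (Fin (c + e))).filter
        (fun a : Fin (c + e) => ∃ b : Fin (c + e), (b : ℕ) < c ∧ ∃ l : Fin K, ε a b l ≠ 0)).powersetCard c).card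
      ≤ (c + 1) ^ w := by
  classical
  rw [card_powersetCard]
  calc _ ≤ (c + w).choose c := Nat.choose_le_choose c hN
    _ = Nat.multichoose (w + 1) c := by
        rw [Nat.multichoose_eq]
        congr 1; omega
    _ ≤ (c + 1) ^ (w + 1 - 1) := multichoose_le_succ_pow (w + 1) c
    _ = (c + 1) ^ w := by simp

/-- the first restricted design (any injective row enumeration, first column block) keeps surplus `≤ w`. [folklore] -/
theorem surplus_restrict_left (ε : Fin (c + e) → Fin (c + e) → Fin K → ℤ)
    (hε : ∀ c₀ : ℕ, ((univ : Finset (Fin (c + e))).filter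
        (fun a : Fin (c + e) => ∃ b : Fin (c + e), (b : ℕ) < c₀ ∧ ∃ l : Fin K, ε a b l ≠ 0)).card ≤ c₀ + w)
    (r : Fin c ↪o Fin (c + e)) (c₀ : ℕ) :
    ((univ : Finset (Fin c)).filter
        (fun i : Fin c => ∃ j : Fin c, (j : ℕ) < c₀ ∧ ∃ l : Fin K, ε (r i) (Fin.castAdd e j) l ≠ 0)).card ≤ c₀ + w := by
  classical
  refine le_trans ?_ (hε c₀)
  refine card_le_card_of_injOn r (fun i hi => ?_) (fun x _ y _ h => r.injective h)
  rw [mem_coe, mem_filter] at hi ⊢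
  obtain ⟨_, j, hj, l, hl⟩ := hi
  exact ⟨mem_univ _, Fin.castAdd e j, by simpa using hj, l, hl⟩

/-- the second restricted design at a state `R ⊆ N([0,c))`, `#R = c` (rows outside `R`, any injective enumeration;
second column block) keeps surplus `≤ w`: its neighbourhoods inject into `N([0, c + c₀)) ∖ R`. [folklore] -/
theorem surplus_restrict_right (ε : Fin (c + e) → Fin (c + e) → Fin K → ℤ)
    (hε : ∀ c₀ : ℕ, ((univ : Finset (Fin (c + e))).filter
        (fun a : Fin (c + e) => ∃ b : Fin (c + e), (b : ℕ) < c₀ ∧ ∃ l : Fin K, ε a b l ≠ 0)).card ≤ c₀ + w)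
    (R : Finset (Fin (c + e)))
    (hRN : R ⊆ (univ : Finset (Fin (c + e))).filter
        (fun a : Fin (c + e) => ∃ b : Fin (c + e), (b : ℕ) < c ∧ ∃ l : Fin K, ε a b l ≠ 0))
    (hRc : R.card = c) (r : Fin e ↪o Fin (c + e)) (hrR : ∀ i, r i ∉ R) (c₀ : ℕ) :
    ((univ : Finset (Fin e)).filter
        (fun i : Fin e => ∃ j : Fin e, (j : ℕ) < c₀ ∧ ∃ l : Fin K, ε (r i) (Fin.natAdd c j) l ≠ 0)).card ≤ c₀ + w := by
  classical
  set N := (univ : Finset (Fin (c + e))).filter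
    (fun a : Fin (c + e) => ∃ b : Fin (c + e), (b : ℕ) < c + c₀ ∧ ∃ l : Fin K, ε a b l ≠ 0) with hNdef
  have hRN' : R ⊆ N := hRN.trans (nbhd_mono ε (Nat.le_add_right c c₀))
  have hNcard : N.card ≤ c + c₀ + w := hε (c + c₀)
  have hdiff : (N \ R).card ≤ c₀ + w := by rw [card_sdiff_of_subset hRN']; omega
  refine le_trans ?_ hdiff
  refine card_le_card_of_injOn r (fun i hi => ?_) (fun x _ y _ h => r.injective h)
  rw [mem_coe, mem_filter] at hi
  obtain ⟨_, j, hj, l, hl⟩ := hi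
  rw [mem_coe, mem_sdiff]
  refine ⟨mem_filter.mpr ⟨mem_univ _, Fin.natAdd c j, by simp; omega, l, hl⟩, hrR i⟩

end SurplusSplit

/-! ## 3. The quasi-polynomial bound under surplus `≤ w` -/

/-- **Gusfield's bound, surplus form, dyadic.**  Every design of format `m ≤ 2^t` with `K` classes and surplus `≤ w` has
unsigned row bound `(K + 1)·2^((w+1)·(t·(t+1))) − 1`. [folklore: Gusfield 1980, Hall-surplus form] -/
theorem designRowD_surplus_pow (K w t : ℕ) : ∀ m : ℕ, m ≤ 2 ^ t →
    ∀ (d : Fin K → ℕ) (v ε : Fin m → Fin m → Fin K → ℤ),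
      (∀ c : ℕ, ((univ : Finset (Fin m)).filter
        (fun a : Fin m => ∃ b : Fin m, (b : ℕ) < c ∧ ∃ l : Fin K, ε a b l ≠ 0)).card ≤ c + w) →
      DesignRowD d v ε ((K + 1) * 2 ^ ((w + 1) * (t * (t + 1))) - 1) := by
  induction t with
  | zero =>
    intro m hm d v ε _
    have hm1 : m ≤ 1 := by simpa using hm
    rcases Nat.le_one_iff_eq_zero_or_eq_one.mp hm1 with rfl | rfl
    · exact designRowD_mono (Nat.zero_le _) (tropRowD_size_zero K 0 d v ε)
    · refine designRowD_mono ?_ (tropRowD_one K d v ε)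
      simp
  | succ t ih =>
    intro m hm d v ε hε
    set G := (K + 1) * 2 ^ ((w + 1) * (t * (t + 1))) with hG
    have hmonoG : G - 1 ≤ (K + 1) * 2 ^ ((w + 1) * ((t + 1) * (t + 1 + 1))) - 1 := by
      have : 2 ^ ((w + 1) * (t * (t + 1))) ≤ 2 ^ ((w + 1) * ((t + 1) * (t + 1 + 1))) :=
        Nat.pow_le_pow_right (by norm_num) (Nat.mul_le_mul_left _ (by nlinarith))
      have := Nat.mul_le_mul_left (K + 1) this
      simp only [hG]; omega
    by_cases hsmall : m ≤ 2 ^ t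
    · exact designRowD_mono hmonoG (ih m hsmall d v ε hε)
    obtain ⟨c, e', rfl, hc, he', hce⟩ : ∃ c e', m = c + e' ∧ c ≤ 2 ^ t ∧ e' ≤ 2 ^ t ∧ c ≤ e' := by
      refine ⟨m / 2, m - m / 2, by omega, ?_, ?_, by omega⟩
      · have : 2 ^ (t + 1) = 2 * 2 ^ t := by ring
        omega
      · have : 2 ^ (t + 1) = 2 * 2 ^ t := by ring
        omega
    classical
    set 𝓡 := ((univ : Finset (Fin (c + e'))).filter
        (fun a : Fin (c + e') => ∃ b : Fin (c + e'), (b : ℕ) < c ∧ ∃ l : Fin K, ε a b l ≠ 0)).powersetCard c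
      with h𝓡def
    have hsplit := designRowD_split d v ε 𝓡 (fun R hR => (mem_powersetCard.mp hR).2)
      (B₁ := G - 1) (B₂ := G - 1)
      (fun R _ r _ => ih c hc d _ _ (surplus_restrict_left w ε hε r))
      (fun R hR r hr => ih e' he' d _ _
        (surplus_restrict_right w ε hε R (mem_powersetCard.mp hR).1 (mem_powersetCard.mp hR).2 r hr))
      (fun q hq => surplus_state_mem ε q hq)
    refine designRowD_mono ?_ hsplit
    have hstates : 𝓡.card ≤ 2 ^ ((t + 1) * w) := by
      calc 𝓡.card ≤ (c + 1) ^ w := card_surplusStates_le w ε (hε c)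
        _ ≤ (2 ^ (t + 1)) ^ w := Nat.pow_le_pow_left (by
            have : 2 ^ (t + 1) = 2 * 2 ^ t := by ring
            have : 1 ≤ 2 ^ t := Nat.one_le_two_pow
            omega) w
        _ = 2 ^ ((t + 1) * w) := by rw [← pow_mul]
    have hGpos : 1 ≤ G := by
      have : 1 ≤ 2 ^ ((w + 1) * (t * (t + 1))) := Nat.one_le_two_pow
      simp only [hG]; nlinarith
    have h1 : 𝓡.card * (G - 1 + (G - 1) + 1) ≤ 2 ^ ((t + 1) * w) * (2 * G) :=
      calc 𝓡.card * (G - 1 + (G - 1) + 1) ≤ 2 ^ ((t + 1) * w) * (G - 1 + (G - 1) + 1) :=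
            Nat.mul_le_mul_right _ hstates
        _ ≤ 2 ^ ((t + 1) * w) * (2 * G) := Nat.mul_le_mul_left _ (by omega)
    have h2 : 2 ^ ((t + 1) * w) * (2 * G) ≤ (K + 1) * 2 ^ ((w + 1) * ((t + 1) * (t + 1 + 1))) := by
      have hexp : 2 ^ ((t + 1) * w) * 2 * 2 ^ ((w + 1) * (t * (t + 1))) ≤
          2 ^ ((w + 1) * ((t + 1) * (t + 1 + 1))) := by
        rw [← pow_succ, ← pow_add]
        exact Nat.pow_le_pow_right (by norm_num) (by nlinarith)
      calc 2 ^ ((t + 1) * w) * (2 * G) = (K + 1) * (2 ^ ((t + 1) * w) * 2 * 2 ^ ((w + 1) * (t * (t + 1)))) := by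
            simp only [hG]; ring
        _ ≤ (K + 1) * 2 ^ ((w + 1) * ((t + 1) * (t + 1 + 1))) := Nat.mul_le_mul_left _ hexp
    omega

/-- **Gusfield's bound, surplus form.** [folklore: Gusfield 1980, Hall-surplus form] -/
theorem designRowD_surplus {m K : ℕ} (w : ℕ) (d : Fin K → ℕ) (v ε : Fin m → Fin m → Fin K → ℤ)
    (hε : ∀ c : ℕ, ((univ : Finset (Fin m)).filter
        (fun a : Fin m => ∃ b : Fin m, (b : ℕ) < c ∧ ∃ l : Fin K, ε a b l ≠ 0)).card ≤ c + w) :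
    DesignRowD d v ε ((K + 1) * 2 ^ ((w + 1) * ((Nat.log 2 m + 1) * (Nat.log 2 m + 2))) - 1) :=
  designRowD_surplus_pow K w (Nat.log 2 m + 1) m (Nat.lt_pow_succ_log_self (by norm_num) m).le d v ε hε

/-- **The `K + log² m` law under surplus `≤ w`, fixed width (unsigned form): `C = 6w + 7`.** [folklore] -/
theorem surplus_kPlusLogSq_fixedWidth_unsigned {m K : ℕ} (w : ℕ) (d : Fin K → ℕ)
    (v ε : Fin m → Fin m → Fin K → ℤ)
    (hε : ∀ c : ℕ, ((univ : Finset (Fin m)).filter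
        (fun a : Fin m => ∃ b : Fin m, (b : ℕ) < c ∧ ∃ l : Fin K, ε a b l ≠ 0)).card ≤ c + w) :
    DesignRowD d v ε (2 ^ ((6 * w + 7) * (K + Nat.log 2 m ^ 2))) := by
  rcases Nat.lt_or_ge m 2 with hm | hm
  · exact designRowD_small (by omega) _ (by omega) d v ε
  · have hL : 1 ≤ Nat.log 2 m := Nat.log_pos (by norm_num) hm
    exact designRowD_mono (bandBound_le_fixedWidth K _ w hL) (designRowD_surplus w d v ε hε)

/-- **The `K + log² m` law under K-ADAPTIVE surplus (unsigned form): `C = 7` whenever `w · log₂² m ≤ K`.** [folklore] -/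
theorem surplus_kPlusLogSq_unsigned {m K : ℕ} (w : ℕ) (d : Fin K → ℕ) (v ε : Fin m → Fin m → Fin K → ℤ)
    (hε : ∀ c : ℕ, ((univ : Finset (Fin m)).filter
        (fun a : Fin m => ∃ b : Fin m, (b : ℕ) < c ∧ ∃ l : Fin K, ε a b l ≠ 0)).card ≤ c + w)
    (hw : w * Nat.log 2 m ^ 2 ≤ K) : DesignRowD d v ε (2 ^ (7 * (K + Nat.log 2 m ^ 2))) := by
  rcases Nat.lt_or_ge m 2 with hm | hm
  · exact designRowD_small (by omega) _ (by omega) d v ε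
  · have hL : 1 ≤ Nat.log 2 m := Nat.log_pos (by norm_num) hm
    exact designRowD_mono (bandBound_le_adaptive K _ w hL hw) (designRowD_surplus w d v ε hε)

/-- **The `K + log² m` law under surplus `≤ w`, fixed width.**  For every `w` there is `C` (`= 6w + 7`) such that for all
`m, K` and every design of format `(m, K)` all of whose initial column segments `[0, c)` meet at most `c + w` rows, every
sign-alternating dominant chain has at most `2^(C·(K + (log₂ m)²))` breakpoints.  HONEST RANGE: a restricted class.
[folklore: Gusfield 1980, Hall-surplus form, in the dominance vocabulary] -/
theorem surplus_kPlusLogSq_fixedWidth (w : ℕ) : ∃ C : ℕ, ∀ (m K : ℕ) (d : Fin K → ℕ)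
    (v ε : Fin m → Fin m → Fin K → ℤ),
    (∀ c : ℕ, ((univ : Finset (Fin m)).filter
        (fun a : Fin m => ∃ b : Fin m, (b : ℕ) < c ∧ ∃ l : Fin K, ε a b l ≠ 0)).card ≤ c + w) →
    ∀ (n : ℕ) (θ : Fin (n + 1) → ℤ) (p : Fin (n + 1) → Equiv.Perm (Fin m) × (Fin m → Fin K)),
      (∀ i j l, (ε i j l).natAbs ≤ 1) → StrictMono θ → (∀ k, IsDominant d v ε (θ k) (p k)) →
      (∀ k : Fin n, termSign ε (p k.castSucc) * termSign ε (p k.succ) < 0) →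
      n ≤ 2 ^ (C * (K + Nat.log 2 m ^ 2)) :=
  ⟨6 * w + 7, fun _ _ d v ε hε _ θ p _ hθ hdom halt =>
    le_of_designRowD (surplus_kPlusLogSq_fixedWidth_unsigned w d v ε hε) θ p hθ hdom halt⟩

/-- **The `K + log² m` law under K-adaptive surplus: ONE absolute constant.**  For all `m, K, w` with
`w · (log₂ m)² ≤ K` and every design of format `(m, K)` all of whose initial column segments `[0, c)` meet at most
`c + w` rows, every sign-alternating dominant chain has at most `2^(7·(K + (log₂ m)²))` breakpoints.  HONEST RANGE: a
restricted class; `TropicalB` quantifies over all designs. [folklore: Gusfield 1980, Hall-surplus form] -/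
theorem surplus_kPlusLogSq {m K : ℕ} (w : ℕ) (d : Fin K → ℕ) (v ε : Fin m → Fin m → Fin K → ℤ)
    (hε : ∀ c : ℕ, ((univ : Finset (Fin m)).filter
        (fun a : Fin m => ∃ b : Fin m, (b : ℕ) < c ∧ ∃ l : Fin K, ε a b l ≠ 0)).card ≤ c + w)
    (hw : w * Nat.log 2 m ^ 2 ≤ K)
    {n : ℕ} (θ : Fin (n + 1) → ℤ) (p : Fin (n + 1) → Equiv.Perm (Fin m) × (Fin m → Fin K))
    (hθ : StrictMono θ) (hdom : ∀ k, IsDominant d v ε (θ k) (p k))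
    (halt : ∀ k : Fin n, termSign ε (p k.castSucc) * termSign ε (p k.succ) < 0) :
    n ≤ 2 ^ (7 * (K + Nat.log 2 m ^ 2)) :=
  le_of_designRowD (surplus_kPlusLogSq_unsigned w d v ε hε hw) θ p hθ hdom halt

/-- **Column orders of small surplus.**  If SOME relabeling of rows (`π`) and columns (`ρ`) has surplus `≤ w` with
`w · (log₂ m)² ≤ K` — i.e. the support graph admits a column order whose initial segments have neighbourhood surplus
`≤ w` — the bound `2^(7·(K + (log₂ m)²))` holds for the design itself (val-sym-trop-p1's `designRowD_of_relabel`).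
[folklore] -/
theorem surplus_kPlusLogSq_of_relabel {m K : ℕ} (w : ℕ) (d : Fin K → ℕ) (v ε : Fin m → Fin m → Fin K → ℤ)
    (π ρ : Equiv.Perm (Fin m))
    (hε : ∀ c : ℕ, ((univ : Finset (Fin m)).filter
        (fun a : Fin m => ∃ b : Fin m, (b : ℕ) < c ∧ ∃ l : Fin K, ε (π a) (ρ b) l ≠ 0)).card ≤ c + w)
    (hw : w * Nat.log 2 m ^ 2 ≤ K)
    {n : ℕ} (θ : Fin (n + 1) → ℤ) (p : Fin (n + 1) → Equiv.Perm (Fin m) × (Fin m → Fin K))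
    (hθ : StrictMono θ) (hdom : ∀ k, IsDominant d v ε (θ k) (p k))
    (halt : ∀ k : Fin n, termSign ε (p k.castSucc) * termSign ε (p k.succ) < 0) :
    n ≤ 2 ^ (7 * (K + Nat.log 2 m ^ 2)) :=
  le_of_designRowD (designRowD_of_relabel d v ε π ρ
    (surplus_kPlusLogSq_unsigned w d (fun a b l => v (π a) (ρ b) l) (fun a b l => ε (π a) (ρ b) l) hε hw))
    θ p hθ hdom halt

/-! ## 4. The row twin (appended): initial ROW segments, by transposition -/

/-- **Hall surplus along initial ROW segments.**  For all `m, K, w` with `w · (log₂ m)² ≤ K` and every design of format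
`(m, K)` all of whose initial row segments `[0, c)` meet at most `c + w` columns, every sign-alternating dominant chain has
at most `2^(7·(K + (log₂ m)²))` breakpoints: the transposed design has column surplus `≤ w`, and the unsigned row bound
transports back by val-sym-trop-p1's `designRowD_of_transpose`.  HONEST RANGE: a restricted class. [folklore] -/
theorem surplus_kPlusLogSq_rows {m K : ℕ} (w : ℕ) (d : Fin K → ℕ) (v ε : Fin m → Fin m → Fin K → ℤ)
    (hε : ∀ c : ℕ, ((univ : Finset (Fin m)).filter
        (fun b : Fin m => ∃ a : Fin m, (a : ℕ) < c ∧ ∃ l : Fin K, ε a b l ≠ 0)).card ≤ c + w)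
    (hw : w * Nat.log 2 m ^ 2 ≤ K)
    {n : ℕ} (θ : Fin (n + 1) → ℤ) (p : Fin (n + 1) → Equiv.Perm (Fin m) × (Fin m → Fin K))
    (hθ : StrictMono θ) (hdom : ∀ k, IsDominant d v ε (θ k) (p k))
    (halt : ∀ k : Fin n, termSign ε (p k.castSucc) * termSign ε (p k.succ) < 0) :
    n ≤ 2 ^ (7 * (K + Nat.log 2 m ^ 2)) :=
  le_of_designRowD (designRowD_of_transpose d v ε
    (surplus_kPlusLogSq_unsigned w d (fun a b l => v b a l) (fun a b l => ε b a l) hε hw)) θ p hθ hdom halt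

/-- the same if SOME relabeling of rows (`π`) and columns (`ρ`) has row surplus `≤ w`. [folklore] -/
theorem surplus_kPlusLogSq_rows_of_relabel {m K : ℕ} (w : ℕ) (d : Fin K → ℕ) (v ε : Fin m → Fin m → Fin K → ℤ)
    (π ρ : Equiv.Perm (Fin m))
    (hε : ∀ c : ℕ, ((univ : Finset (Fin m)).filter
        (fun b : Fin m => ∃ a : Fin m, (a : ℕ) < c ∧ ∃ l : Fin K, ε (π a) (ρ b) l ≠ 0)).card ≤ c + w)
    (hw : w * Nat.log 2 m ^ 2 ≤ K)
    {n : ℕ} (θ : Fin (n + 1) → ℤ) (p : Fin (n + 1) → Equiv.Perm (Fin m) × (Fin m → Fin K))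
    (hθ : StrictMono θ) (hdom : ∀ k, IsDominant d v ε (θ k) (p k))
    (halt : ∀ k : Fin n, termSign ε (p k.castSucc) * termSign ε (p k.succ) < 0) :
    n ≤ 2 ^ (7 * (K + Nat.log 2 m ^ 2)) :=
  le_of_designRowD (designRowD_of_relabel d v ε π ρ (designRowD_of_transpose d _ _
    (surplus_kPlusLogSq_unsigned w d (fun a b l => v (π b) (ρ a) l) (fun a b l => ε (π b) (ρ a) l) hε hw)))
    θ p hθ hdom halt

end Summit.ValiantsHypothesis.ValiantsHypothesis.Theorems.KPlusLogSqLaw
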